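import Literature.Analysis.FluidPDE.NSLocalAnalyticityRadiusTube
import Literature.Analysis.FluidPDE.SpaceTimeRescaling
import HarnessLib

/-!
# BGK local analyticity radius: tools for the parabolic-scaling reduction

Analysis/FluidPDE proofs file (theorems only), companion of `NSLocalAnalyticityRadius.lean`
(named fact `bradshawGrujicKukavica2015_local_analyticity_radius`, Bradshaw–Grujić–Kukavica,
J. Differential Equations 259 (2015), Thm. 2.3). The statement of the fact is covariant under
the parabolic scaling `u ↦ c u(c²s, x_c + c y)`, `p ↦ c² p(c²s, x_c + c y)` of the Navier–Stokes
equations (`c = √t`): the three local quantities pick up the factor `c^{1-3/q}`, the window the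
factor `c⁻²`, the region `Ω_*(t)` becomes `Ω_*(1)`. This file collects the measure-theoretic and
arithmetic identities of that reduction (`NSLocalAnalyticityRadiusScaling.lean`):

* `eLpNorm_smul_comp_space_affine_restrict` — `‖α g(x₀ + γ·)‖_{L^q(A⁻¹S)} =
  ‖α‖ (γⁿ)^{-1/q} ‖g‖_{L^q(S)}`;
* `lintegral_Ioo_div_comp_mul` — `∫_{(a/β, b/β)} G(βs) ds = β⁻¹ ∫_{(a,b)} G`;
* `enorm_mul_volFactor_eq_ofReal_rpow` and the `rpow` bookkeeping `bgk_rpow_*`;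
* `bgk_window_rescale` — the window computed from the rescaled data is `c⁻²` times the window;
* `differentiableOn_rescale_localComplexTube` — transport of a holomorphic extension on
  `Ω_*(1)` over `B(0, r_*/c)` back to `Ω` of height `c h` over `B(x_c, r_*)`.

## References

* Z. Bradshaw, Z. Grujić, I. Kukavica, J. Differential Equations 259 (2015), Thm. 2.3.
  [BradshawGrujicKukavica2015]
* L. Caffarelli, R. Kohn, L. Nirenberg, Comm. Pure Appl. Math. 35 (1982), (1.5)–(1.6)
  (parabolic scaling of local quantities). [CaffarelliKohnNirenberg1982]
-/

noncomputable section

open MeasureTheory Set Function Filter TopologicalSpace Metric Module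
open _root_.Topology
open scoped ENNReal
open Literature.Analysis.FunctionSpaces.EuclideanSpace (complexify complexify_apply norm_complexify
  complexify_injective continuous_complexify)

namespace Literature.Analysis.FluidPDE

/-! ### `L^q` norms on balls under space dilations -/

section Space

variable {E : Type*} [NormedAddCommGroup E] [InnerProductSpace ℝ E] [FiniteDimensional ℝ E]
  [MeasurableSpace E] [BorelSpace E]

/-- **`L^q` norms under a space dilation**: for `A y = x₀ + γ y`, `γ > 0`,
`‖α • g ∘ A‖_{L^q(A⁻¹ S)} = ‖α‖ · ((γⁿ)⁻¹)^{1/q} · ‖g‖_{L^q(S)}` (the Jacobian of `A` is `γⁿ`).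
[folklore] -/
theorem eLpNorm_smul_comp_space_affine_restrict {F : Type*} [NormedAddCommGroup F]
    [NormedSpace ℝ F] (g : E → F) (α : ℝ) {γ : ℝ} (hγ : 0 < γ) (x₀ : E) (S : Set E)
    (q : ℝ≥0∞) :
    eLpNorm (fun y => α • g (x₀ + γ • y)) q
        (volume.restrict ((fun y : E => x₀ + γ • y) ⁻¹' S)) =
      ‖α‖ₑ * ((ENNReal.ofReal (γ ^ finrank ℝ E)⁻¹) ^ (1 / q).toReal *
        eLpNorm g q (volume.restrict S)) := by
  have hme := (spaceAffineHomeomorph hγ.ne' x₀).measurableEmbedding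
  rw [show (fun y => α • g (x₀ + γ • y)) = α • (g ∘ fun y : E => x₀ + γ • y) from rfl,
    eLpNorm_const_smul]
  congr 1
  have h1 := hme.restrict_map (volume : Measure E) S
  have h2 := hme.eLpNorm_map_measure (g := g) (p := q)
    (μ := (volume : Measure E).restrict ((fun y : E => x₀ + γ • y) ⁻¹' S))
  rw [coe_spaceAffineHomeomorph] at h1 h2
  rw [← h2, ← h1, map_space_affine_volume hγ, Measure.restrict_smul,
    eLpNorm_smul_measure_of_ne_zero, smul_eq_mul]
  exact (ENNReal.ofReal_pos.2 (by positivity)).ne'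

/-- The same on balls about the centre of the dilation: `A⁻¹ B(x₀, γR) = B(0, R)`. [folklore] -/
theorem eLpNorm_smul_comp_space_affine_restrict_ball {F : Type*} [NormedAddCommGroup F]
    [NormedSpace ℝ F] (g : E → F) (α : ℝ) {γ : ℝ} (hγ : 0 < γ) (x₀ : E) (R : ℝ)
    (q : ℝ≥0∞) :
    eLpNorm (fun y => α • g (x₀ + γ • y)) q (volume.restrict (ball (0 : E) R)) =
      ‖α‖ₑ * ((ENNReal.ofReal (γ ^ finrank ℝ E)⁻¹) ^ (1 / q).toReal *
        eLpNorm g q (volume.restrict (ball x₀ (γ * R)))) := by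
  have hpre : (fun y : E => x₀ + γ • y) ⁻¹' ball x₀ (γ * R) = ball (0 : E) R := by
    rw [space_affine_preimage_ball hγ, sub_self, smul_zero, mul_div_cancel_left₀ _ hγ.ne']
  rw [← hpre]
  exact eLpNorm_smul_comp_space_affine_restrict g α hγ x₀ _ q

end Space

/-! ### Time dilations of `lintegral`s over intervals -/

/-- **Time change of variables** `τ = βs`, `β > 0`: `∫_{(a/β, b/β)} G(βs) ds = β⁻¹ ∫_{(a,b)} G`.
[folklore] -/
theorem lintegral_Ioo_div_comp_mul {β : ℝ} (hβ : 0 < β) (a b : ℝ) (G : ℝ → ℝ≥0∞) :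
    ∫⁻ s in Ioo (a / β) (b / β), G (β * s) = ENNReal.ofReal β⁻¹ * ∫⁻ τ in Ioo a b, G τ := by
  have hpre : (fun s : ℝ => (0 : ℝ) + β • s) ⁻¹' Ioo a b = Ioo (a / β) (b / β) := by
    ext s
    simp only [mem_preimage, zero_add, smul_eq_mul, mem_Ioo, div_lt_iff₀ hβ, lt_div_iff₀ hβ]
    constructor <;> rintro ⟨h₁, h₂⟩ <;> constructor <;> linarith
  have h := setLIntegral_preimage_comp_space_affine (E := ℝ) hβ 0 G (Ioo a b)
  rw [hpre] at h
  simp only [zero_add, smul_eq_mul, finrank_self, pow_one] at h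
  exact h

/-! ### `rpow` bookkeeping -/

/-- `‖α‖ₑ · ((c³)⁻¹)^{1/q} = ofReal (α c^{-3/q})` for `α ≥ 0`, `c > 0`, `q > 0` real. [folklore] -/
theorem enorm_mul_volFactor_eq_ofReal {α c q : ℝ} (hα : 0 ≤ α) (hc : 0 < c) (hq : 0 < q) :
    ‖α‖ₑ * (ENNReal.ofReal (c ^ 3)⁻¹) ^ (1 / ENNReal.ofReal q).toReal =
      ENNReal.ofReal (α * c ^ (-3 / q)) := by
  rw [Real.enorm_eq_ofReal hα, ENNReal.toReal_div, ENNReal.toReal_one,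
    ENNReal.toReal_ofReal hq.le, ENNReal.ofReal_rpow_of_pos (by positivity),
    ← ENNReal.ofReal_mul hα]
  congr 1
  congr 1
  have h3 : (c ^ 3)⁻¹ = c ^ (-3 : ℝ) := by
    rw [Real.rpow_neg hc.le, Real.rpow_ofNat]
  rw [h3, ← Real.rpow_mul hc.le]
  congr 1
  ring

/-- `c · c^{-3/q} = c^{1 - 3/q}` (`c > 0`). [folklore] -/
theorem bgk_rpow_one {c q : ℝ} (hc : 0 < c) : c * c ^ (-3 / q) = c ^ (1 - 3 / q) := by
  rw [show (1 : ℝ) - 3 / q = 1 + -3 / q by ring, Real.rpow_add hc, Real.rpow_one]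

/-- `c² · c^{-3/q} = c^{2 - 3/q}` (`c > 0`). [folklore] -/
theorem bgk_rpow_two {c q : ℝ} (hc : 0 < c) : c ^ 2 * c ^ (-3 / q) = c ^ (2 - 3 / q) := by
  rw [show (2 : ℝ) - 3 / q = 2 + -3 / q by ring, Real.rpow_add hc, Real.rpow_two]

/-- The gradient majorant after scaling: with `D' = c^{2-3/q-2/r} D`,
`c^{(2-3/q)r} · (c²)⁻¹ · D^r = D'^r` (`c > 0`, `D ≥ 0`, `r > 0`). [folklore] -/
theorem bgk_rpow_grad {c q r D : ℝ} (hc : 0 < c) (hD : 0 ≤ D) (hr : 0 < r) :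
    c ^ ((2 - 3 / q) * r) * (c ^ 2)⁻¹ * D ^ r = (c ^ (2 - 3 / q - 2 / r) * D) ^ r := by
  rw [Real.mul_rpow (Real.rpow_nonneg hc.le _) hD, ← Real.rpow_mul hc.le]
  congr 1
  rw [show (c ^ 2)⁻¹ = c ^ (-2 : ℝ) by rw [Real.rpow_neg hc.le, Real.rpow_two],
    ← Real.rpow_add hc]
  congr 1
  field_simp
  ring

/-- The local quantity after scaling: `c^{1-3/q}A + c^{1-3/q}B + (T₀/c²)^e (c^{2-3/q-2/r} D)
= c^{1-3/q} (A + B + T₀^e D)`, `e = (r-2)/(2r)` (`c, T₀ > 0`, `r ≠ 0`). [folklore] -/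
theorem bgk_local_quantity_rescale {c q r T₀ A B D : ℝ} (hc : 0 < c) (hT₀ : 0 < T₀) (hr : r ≠ 0) :
    c ^ (1 - 3 / q) * A + c ^ (1 - 3 / q) * B +
        (T₀ / c ^ 2) ^ ((r - 2) / (2 * r)) * (c ^ (2 - 3 / q - 2 / r) * D) =
      c ^ (1 - 3 / q) * (A + B + T₀ ^ ((r - 2) / (2 * r)) * D) := by
  have hc2 : 0 < c ^ 2 := by positivity
  have key : (T₀ / c ^ 2) ^ ((r - 2) / (2 * r)) * c ^ (2 - 3 / q - 2 / r) =
      c ^ (1 - 3 / q) * T₀ ^ ((r - 2) / (2 * r)) := by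
    rw [Real.div_rpow hT₀.le hc2.le, show c ^ 2 = c ^ (2 : ℝ) from (Real.rpow_two c).symm,
      ← Real.rpow_mul hc.le, div_mul_eq_mul_div, mul_div_assoc, ← Real.rpow_sub hc, mul_comm]
    congr 1
    congr 1
    field_simp
    ring
  calc c ^ (1 - 3 / q) * A + c ^ (1 - 3 / q) * B +
        (T₀ / c ^ 2) ^ ((r - 2) / (2 * r)) * (c ^ (2 - 3 / q - 2 / r) * D)
      = c ^ (1 - 3 / q) * A + c ^ (1 - 3 / q) * B +
        ((T₀ / c ^ 2) ^ ((r - 2) / (2 * r)) * c ^ (2 - 3 / q - 2 / r)) * D := by ring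
    _ = _ := by rw [key]; ring

/-- The third entry of the window after scaling:
`(q² (C c^{1-3/q} M)^{2q/(q-3)})⁻¹ = (q² (C M)^{2q/(q-3)})⁻¹ / c²` (`c, C > 0`, `M ≥ 0`, `q > 3`).
[folklore] -/
theorem bgk_window_entry_rescale {c q C M : ℝ} (hc : 0 < c) (hC : 0 < C) (hM : 0 ≤ M)
    (hq : 3 < q) :
    (q ^ 2 * (C * (c ^ (1 - 3 / q) * M)) ^ (2 * q / (q - 3)))⁻¹ =
      (q ^ 2 * (C * M) ^ (2 * q / (q - 3)))⁻¹ / c ^ 2 := by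
  have hq0 : q ≠ 0 := by linarith
  have hq3 : q - 3 ≠ 0 := by linarith
  have hca : 0 ≤ c ^ (1 - 3 / q) := Real.rpow_nonneg hc.le _
  have h1 : C * (c ^ (1 - 3 / q) * M) = c ^ (1 - 3 / q) * (C * M) := by ring
  have hexp : (1 - 3 / q) * (2 * q / (q - 3)) = 2 := by
    field_simp
  have h2 : (c ^ (1 - 3 / q)) ^ (2 * q / (q - 3)) = c ^ 2 := by
    rw [← Real.rpow_mul hc.le, hexp, Real.rpow_two]
  rw [h1, Real.mul_rpow hca (mul_nonneg hC.le hM), h2]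
  ring

/-- **The window is scale covariant**: the window of the rescaled data
(`T₀/c², r_*/c`, local quantity `c^{1-3/q} M`) is `c⁻²` times the original window. [folklore] -/
theorem bgk_window_rescale {c q C T₀ rc M : ℝ} (hc : 0 < c) (hC : 0 < C) (hM : 0 ≤ M)
    (hq : 3 < q) :
    C⁻¹ * min (min (T₀ / c ^ 2) ((rc / c) ^ 2))
        (q ^ 2 * (C * (c ^ (1 - 3 / q) * M)) ^ (2 * q / (q - 3)))⁻¹ =
      C⁻¹ * min (min T₀ (rc ^ 2)) (q ^ 2 * (C * M) ^ (2 * q / (q - 3)))⁻¹ / c ^ 2 := by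
  have hc2 : 0 < c ^ 2 := by positivity
  rw [bgk_window_entry_rescale hc hC hM hq, div_pow, min_div_div_right hc2.le,
    min_div_div_right hc2.le, ← mul_div_assoc]

/-! ### Transport of holomorphic extensions under the scaling -/

/-- The real dilation-translation `z ↦ c⁻¹ • (z - complexify x_c)` of `ℂ³` maps the local region
of height `c h` over `B(x_c, r)` into the local region of height `h` over `B(0, r/c)` (`c > 0`).
[folklore] -/
theorem mapsTo_rescale_localComplexTube {xc : EuclideanSpace ℝ (Fin 3)} {c r h : ℝ}
    (hc : 0 < c) :
    MapsTo (fun z : EuclideanSpace ℂ (Fin 3) => (c⁻¹ : ℝ) • (z - complexify xc))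
      (localComplexTube xc r (c * h)) (localComplexTube 0 (r / c) h) := by
  rintro z ⟨x, y, hx, hy, rfl⟩
  refine ⟨c⁻¹ • (x - xc), c⁻¹ • y, ?_, ?_, ?_⟩
  · rw [dist_zero_right, norm_smul, Real.norm_eq_abs, abs_of_pos (inv_pos.2 hc),
      ← dist_eq_norm, lt_div_iff₀ hc]
    calc c⁻¹ * dist x xc * c = dist x xc := by field_simp
      _ < r := hx
  · rw [norm_smul, Real.norm_eq_abs, abs_of_pos (inv_pos.2 hc)]
    calc c⁻¹ * ‖y‖ < c⁻¹ * (c * h) := mul_lt_mul_of_pos_left hy (inv_pos.2 hc)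
      _ = h := by field_simp
  · show ((c⁻¹ : ℝ) • (complexify x + Complex.I • complexify y - complexify xc) :
        EuclideanSpace ℂ (Fin 3)) = _
    rw [LinearIsometry.map_smul, LinearIsometry.map_smul, map_sub,
      smul_comm Complex.I (c⁻¹ : ℝ) (complexify y), ← smul_add]
    congr 1
    abel

/-- **Transport of a holomorphic extension under the parabolic scaling.** If `U'` is holomorphic
on the local region of height `h` over `B(0, r/c)` and restricts on `B(0, r/c)` to
`y ↦ c • g(x_c + c y)`, then `z ↦ c⁻¹ • U'(c⁻¹ • (z - x_c))` is holomorphic on the local region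
of height `c h` over `B(x_c, r)` and restricts there to `g` (`c > 0`). [folklore] -/
theorem exists_extension_of_rescaled {xc : EuclideanSpace ℝ (Fin 3)} {c r h : ℝ} (hc : 0 < c)
    {g : EuclideanSpace ℝ (Fin 3) → EuclideanSpace ℝ (Fin 3)}
    {U' : EuclideanSpace ℂ (Fin 3) → EuclideanSpace ℂ (Fin 3)}
    (hU' : DifferentiableOn ℂ U' (localComplexTube 0 (r / c) h))
    (hU'g : ∀ y ∈ ball (0 : EuclideanSpace ℝ (Fin 3)) (r / c),
      U' (complexify y) = complexify (c • g (xc + c • y))) :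
    ∃ U : EuclideanSpace ℂ (Fin 3) → EuclideanSpace ℂ (Fin 3),
      DifferentiableOn ℂ U (localComplexTube xc r (c * h)) ∧
      ∀ x ∈ ball xc r, U (complexify x) = complexify (g x) := by
  set A : EuclideanSpace ℂ (Fin 3) → EuclideanSpace ℂ (Fin 3) :=
    fun z => (c⁻¹ : ℝ) • (z - complexify xc) with hA
  have hAd : Differentiable ℂ A := fun z =>
    ((differentiableAt_id.sub (differentiableAt_const _)).const_smul (c⁻¹ : ℝ))
  refine ⟨fun z => (c⁻¹ : ℝ) • U' (A z), ?_, fun x hx => ?_⟩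
  · exact ((hU'.comp hAd.differentiableOn (mapsTo_rescale_localComplexTube hc)).const_smul
      (c⁻¹ : ℝ))
  · have hy : c⁻¹ • (x - xc) ∈ ball (0 : EuclideanSpace ℝ (Fin 3)) (r / c) := by
      rw [mem_ball, dist_zero_right, norm_smul, Real.norm_eq_abs, abs_of_pos (inv_pos.2 hc),
        ← dist_eq_norm, lt_div_iff₀ hc]
      calc c⁻¹ * dist x xc * c = dist x xc := by field_simp
        _ < r := hx
    have hAx : A (complexify x) = complexify (c⁻¹ • (x - xc)) := by
      simp only [hA, LinearIsometry.map_smul, map_sub]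
    have hxx : xc + c • (c⁻¹ • (x - xc)) = x := by
      rw [smul_smul, mul_inv_cancel₀ hc.ne', one_smul, add_sub_cancel]
    show (c⁻¹ : ℝ) • U' (A (complexify x)) = complexify (g x)
    rw [hAx, hU'g _ hy, hxx, ← LinearIsometry.map_smul, smul_smul, inv_mul_cancel₀ hc.ne',
      one_smul]

end Literature.Analysis.FluidPDE

end
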